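import Summits.BirchSwinnertonDyer.BirchSwinnertonDyer.Theorems.SemiOrdinaryEisensteinDescentEisensteinKernelAtThreeTowerFreeOdd
import Summits.BirchSwinnertonDyer.BirchSwinnertonDyer.Theorems.SemiOrdinaryEisensteinDescentWildKolyvaginUpperAtThreeTowerFreePrintClosedSubcells
import HarnessLib

/-!
# Route `SemiOrdinaryEisensteinDescent`, support item `EisensteinKernelAtThreeMultiCarrierOdd`
# (stmt-BirchSwinnertonDyer-25899): THE `closes` KERNEL after act G (route rev 18) — published inputs → restricted Eisenstein
# inclusion E′ (24155) → Kolyvagin primitives (print package, 25896) → Jetchev max-form mod 3 (tree debt, 25897) → J‴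
# (σ-divisibility on multi-carrier frames, 25898) → Hsieh ∧ BDP ∧ LZZ print → odd-`d_K` frame from print → Poitou–Tate →
# rank-zero twist Z (20387) ⟹ the leaf `WAllExclAddWildRankOneSurj`, PROVED

Cell `bsd-wall` (W-ALL row 2·3@3 lane 3), width seat `bsd-wall-soed-p2-w3` (gen 2), 2026-08-28, on the route pen's act G
(planner bsd-wall-pss3x g3; scratch `soedG/SketchG.lean` §K, certified rc 0 / 0 sorry before filing). The theorem below has
LITERALLY the type
`Summit.BirchSwinnertonDyer.BirchSwinnertonDyer.Theses.SemiOrdinaryEisensteinDescent.EisensteinKernelAtThreeMultiCarrierOdd`.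

PROOF (the item's recipe, zero new mathematics): unpack the primitives package `hPr = ⟨hCT, h372, hE0⟩`; feed the Jetchev
max-form item at `(hPT, hE0, h372)` and the research residue J‴ to w2 g4's
`WildKolyvaginUpperAtThreeTowerFreePrintClosedSubcells.wildKolyvaginUpperAtThreeTowerFree_of_sigmaMultiCarrier_of_jetchevMaxModThree_of_threePrimitives`
(p598295 §2) to obtain the tower-free Kolyvagin upper bound Ko′ (24696, now aside) BY NAME; then run the landed kernel‴
`semiOrdinaryEisensteinDescent_eisensteinKernelAtThreeTowerFreeOdd_proof` (24697, soed-p1-w3 g6) with Ko′ in its third slot.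

HONEST FRAMING. This closes a SUPPORT (kernel) item: an implication whose research hypotheses E′ (24155), J‴ (25898) and
Z (20387) stay OPEN, and whose print hypotheses (published-inputs package, Kolyvagin primitives, Poitou–Tate, Hsieh/BDP/LZZ)
are Literature named facts. Nothing about any curve is asserted unconditionally. BSD is not proved by this file.
-/

set_option autoImplicit false
set_option linter.dupNamespace false -- `Summit.BirchSwinnertonDyer.BirchSwinnertonDyer.…` is the tree's layout (D-0017)

noncomputable section

open scoped Classical

namespace Summit.BirchSwinnertonDyer.BirchSwinnertonDyer.Theorems

open Summit.BirchSwinnertonDyer.BirchSwinnertonDyer.Theses.SemiOrdinaryEisensteinDescent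

/-- **Kernel‴′ `EisensteinKernelAtThreeMultiCarrierOdd` (stmt-BirchSwinnertonDyer-25899), PROVED**: published inputs → E′ →
Kolyvagin primitives → Jetchev max-form mod `3` → J‴ → printed-inputs package → odd-`d_K` frame from print → Poitou–Tate →
rank-zero twist ⟹ `WAllExclAddWildRankOneSurj`. Proof = act G's certified recipe: Ko′ from {CT, 3.7 (2), E0} + Jetchev max
(fed `hPT hE0 h372`) + J‴ by p598295 §2, then the kernel‴ of 24697 with Ko′ in place. An implication between named route
statements; its research antecedents stay open. [cite: McCallumLMS1991, §5 Cor. 5.6 (p. 310)]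
[cite: Jetchev2008, Thm. 1.4 and Conj. 1.3 (p. 812)] -/
theorem semiOrdinaryEisensteinDescent_eisensteinKernelAtThreeMultiCarrierOdd_proof :
    EisensteinKernelAtThreeMultiCarrierOdd := by
  intro hIn hE' hPr hJmax hJ hW hS hPT hZ
  obtain ⟨hCT, h372, hE0⟩ := hPr
  exact semiOrdinaryEisensteinDescent_eisensteinKernelAtThreeTowerFreeOdd_proof hIn hE'
    (WildKolyvaginUpperAtThreeTowerFreePrintClosedSubcells.wildKolyvaginUpperAtThreeTowerFree_of_sigmaMultiCarrier_of_jetchevMaxModThree_of_threePrimitives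
      hCT h372 hE0 (hJmax hPT hE0 h372) hJ) hW hS hPT hZ

end Summit.BirchSwinnertonDyer.BirchSwinnertonDyer.Theorems

end
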